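import Literature.MathematicalPhysics.QuantumFieldTheory.OSFrameBounds
import Literature.MathematicalPhysics.QuantumFieldTheory.OSPointwiseAnalyticity
import HarnessLib

/-!
# Quantitative skeleton data for a time-ordered configuration (towards OS II Thm. 4.1 (4.5))

Topic `Literature/MathematicalPhysics/QuantumFieldTheory`; support file for the temperedness
estimate (4.5) of Osterwalder–Schrader II, Thm. 4.1. `OSPointwiseAnalyticity.exists_skeleton_data`
produces, for a strictly time-ordered configuration `x`, frames `ê`, a base `ξ` with a gap `g`, a
width `t` and the parameter point `U₀` with `posAff U₀ = x` — existentially. For the temperedness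
estimate every one of these quantities must be an explicit function of the size `‖x‖` and of the
**minimal time gap** `minGap x`, so this file makes the choices of OS II Ch. V.1 (5.9)–(5.11)
explicit:

* `minGap x` (positive on the ordered region, `≤ 2‖x‖`);
* the cone constant `qsC x = minGap x / (4 (2‖x‖ + 1))`, `ε = qsC x / 4`, the frame
  `qsFrame x = stdFrame ε` (`OSFrameBounds`): linearly independent unit vectors, pairwise nonnegative
  inner products, `‖ê_μ − e₀‖ ≤ 2ε`, and the **quantitative cone inequality**
  `⟪ê_μ, x_{i+1} − x_i⟫ ≥ (7/8)(x⁰_{i+1} − x⁰_i)` (`inner_qsFrame_diff_ge`);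
* the width `qsT x = minGap x / (8 (d + 1))`, the gap `qsG x = minGap x / 4`, the base
  `qsXi x i = (x_{i+1} − x_i) − t ∑_ν ê_ν` with `⟪ê_μ, ξ_i⟫ ≥ g` (`qsG_le_inner_qsXi`) and
  `‖ξ‖ ≤ 2‖x‖ + minGap x / 8`;
* the parameter point `qsU0 x` with `posAff ξ ê hli (qsU0 x) = x` (`posAff_qsU0`) and all tail
  coordinates equal to `t` (`tailR_qsU0`).

## References

* K. Osterwalder, R. Schrader, *Axioms for Euclidean Green's functions II*, Comm. Math. Phys.
  42 (1975) 281–305, Ch. V.1 (5.9)–(5.11), Thm. 4.1 (4.5). [OsterwalderSchraderCMP1975]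
-/

noncomputable section

open MeasureTheory Set Filter Module Metric
open _root_.Topology
open scoped InnerProductSpace RealInnerProductSpace

namespace Literature.MathematicalPhysics.QuantumFieldTheory

open OSFrames

variable {d : ℕ} [NeZero d] {k : ℕ}

/-! ### The minimal time gap -/

/-- **The minimal time gap** `min_i (x⁰_{i+1} − x⁰_i)` of a configuration of `k + 2` points. [cite: OsterwalderSchraderCMP1975, Thm. 4.1 (4.5)] -/
def minGap (x : Fin (k + 2) → EuclideanSpace ℝ (Fin d)) : ℝ :=
  Finset.univ.inf' Finset.univ_nonempty fun i : Fin (k + 1) => x i.succ 0 - x (Fin.castSucc i) 0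

/-- The minimal gap is at most each gap. [folklore] -/
theorem minGap_le (x : Fin (k + 2) → EuclideanSpace ℝ (Fin d)) (i : Fin (k + 1)) :
    minGap x ≤ x i.succ 0 - x (Fin.castSucc i) 0 :=
  Finset.inf'_le (fun i : Fin (k + 1) => x i.succ 0 - x (Fin.castSucc i) 0) (Finset.mem_univ i)

/-- The minimal gap is positive on the ordered region. [folklore] -/
theorem minGap_pos {x : Fin (k + 2) → EuclideanSpace ℝ (Fin d)} (hx : x ∈ orderedRegion k d) : 0 < minGap x :=
  (Finset.lt_inf'_iff _).2 fun i _ => sub_pos.2 (hx i)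

/-- The minimal gap is at most twice the size of the configuration. [folklore] -/
theorem minGap_le_two_mul_norm (x : Fin (k + 2) → EuclideanSpace ℝ (Fin d)) : minGap x ≤ 2 * ‖x‖ := by
  refine (minGap_le x 0).trans ?_
  have h1 : |x (0 : Fin (k + 1)).succ 0| ≤ ‖x‖ := by
    have h := PiLp.norm_apply_le (x (0 : Fin (k + 1)).succ) 0
    rw [Real.norm_eq_abs] at h
    exact h.trans (norm_le_pi_norm x _)
  have h2 : |x (Fin.castSucc (0 : Fin (k + 1))) 0| ≤ ‖x‖ := by
    have h := PiLp.norm_apply_le (x (Fin.castSucc (0 : Fin (k + 1)))) 0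
    rw [Real.norm_eq_abs] at h
    exact h.trans (norm_le_pi_norm x _)
  linarith [(abs_le.1 h1).2, (abs_le.1 h2).1]

/-! ### The frame -/

/-- **The cone constant** `c = minGap x / (4 (2‖x‖ + 1))`. [cite: OsterwalderSchraderCMP1975, Ch. V.1 (5.9)–(5.10)] -/
def qsC (x : Fin (k + 2) → EuclideanSpace ℝ (Fin d)) : ℝ := minGap x / (4 * (2 * ‖x‖ + 1))

/-- **The frame parameter** `ε = c / 4`. [folklore] -/
def qsEps (x : Fin (k + 2) → EuclideanSpace ℝ (Fin d)) : ℝ := qsC x / 4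

/-- **The frame** `ê_μ = (e₀ + ε e_μ)/‖e₀ + ε e_μ‖`. [cite: OsterwalderSchraderCMP1975, Ch. V.1 (5.10)–(5.11)] -/
def qsFrame (x : Fin (k + 2) → EuclideanSpace ℝ (Fin d)) : Fin d → EuclideanSpace ℝ (Fin d) := stdFrame (qsEps x)

/-- `c > 0` on the ordered region. [folklore] -/
theorem qsC_pos {x : Fin (k + 2) → EuclideanSpace ℝ (Fin d)} (hx : x ∈ orderedRegion k d) : 0 < qsC x := by
  unfold qsC; have := minGap_pos hx; positivity

/-- `c < 1/4`. [folklore] -/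
theorem qsC_lt {x : Fin (k + 2) → EuclideanSpace ℝ (Fin d)} (hx : x ∈ orderedRegion k d) : qsC x < 1 / 4 := by
  unfold qsC
  have h1 := minGap_le_two_mul_norm x
  have h2 := minGap_pos hx
  rw [div_lt_iff₀ (by positivity)]
  nlinarith [norm_nonneg x]

/-- `0 < ε`. [folklore] -/
theorem qsEps_pos {x : Fin (k + 2) → EuclideanSpace ℝ (Fin d)} (hx : x ∈ orderedRegion k d) : 0 < qsEps x := by
  unfold qsEps; have := qsC_pos hx; positivity

/-- `ε < 1/16`. [folklore] -/
theorem qsEps_lt {x : Fin (k + 2) → EuclideanSpace ℝ (Fin d)} (hx : x ∈ orderedRegion k d) : qsEps x < 1 / 16 := by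
  unfold qsEps; have := qsC_lt hx; linarith

/-- `|ε| < 1/4` (the form used by `OSFrameBounds`). [folklore] -/
theorem abs_qsEps_lt {x : Fin (k + 2) → EuclideanSpace ℝ (Fin d)} (hx : x ∈ orderedRegion k d) : |qsEps x| < 1 / 4 := by
  rw [abs_of_pos (qsEps_pos hx)]; linarith [qsEps_lt hx]

/-- **The frame is linearly independent.** [folklore] -/
theorem linearIndependent_qsFrame {x : Fin (k + 2) → EuclideanSpace ℝ (Fin d)} (hx : x ∈ orderedRegion k d) :
    LinearIndependent ℝ (qsFrame x) :=
  linearIndependent_stdFrame (qsEps_pos hx).ne' (by linarith [qsEps_pos hx]) ((abs_qsEps_lt hx).trans (by norm_num))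

/-- The frame consists of unit vectors. [folklore] -/
theorem norm_qsFrame {x : Fin (k + 2) → EuclideanSpace ℝ (Fin d)} (hx : x ∈ orderedRegion k d) (μ : Fin d) :
    ‖qsFrame x μ‖ = 1 :=
  norm_stdFrame ((abs_qsEps_lt hx).trans (by norm_num)) μ

/-- The frame vectors see each other at nonnegative times. [folklore] -/
theorem inner_qsFrame_nonneg {x : Fin (k + 2) → EuclideanSpace ℝ (Fin d)} (hx : x ∈ orderedRegion k d) (μ ν : Fin d) :
    0 ≤ ⟪qsFrame x μ, qsFrame x ν⟫ :=
  inner_stdFrame_nonneg (abs_qsEps_lt hx) μ ν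

/-- The frame is within `2ε` of the time axis. [folklore] -/
theorem norm_qsFrame_sub_le {x : Fin (k + 2) → EuclideanSpace ℝ (Fin d)} (hx : x ∈ orderedRegion k d) (μ : Fin d) :
    ‖qsFrame x μ - timeAxis‖ ≤ 2 * qsEps x := by
  have h := norm_stdFrame_sub_le (d := d) ((abs_qsEps_lt hx).trans (by norm_num)) μ
  rwa [abs_of_pos (qsEps_pos hx)] at h

/-- **The quantitative cone inequality**: `⟪ê_μ, x_{i+1} − x_i⟫ ≥ (7/8)(x⁰_{i+1} − x⁰_i)`
(`⟪ê, η⟫ ≥ η⁰ − ‖ê − e₀‖ ‖η‖` with `‖ê − e₀‖ ‖η‖ ≤ 2ε · 2‖x‖ ≤ minGap/8`). [cite: OsterwalderSchraderCMP1975, Ch. V.1 (5.9)–(5.11)] -/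
theorem inner_qsFrame_diff_ge {x : Fin (k + 2) → EuclideanSpace ℝ (Fin d)} (hx : x ∈ orderedRegion k d) (μ : Fin d) (i : Fin (k + 1)) :
    7 / 8 * (x i.succ 0 - x (Fin.castSucc i) 0) ≤ ⟪qsFrame x μ, x i.succ - x (Fin.castSucc i)⟫ := by
  set η : EuclideanSpace ℝ (Fin d) := x i.succ - x (Fin.castSucc i) with hη
  have hgap : minGap x ≤ η 0 := by simpa [hη] using minGap_le x i
  have hη0 : x i.succ 0 - x (Fin.castSucc i) 0 = η 0 := by simp [hη]
  rw [hη0]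
  -- `⟪ê, η⟫ = η⁰ + ⟪ê − e₀, η⟫`
  have h1 : ⟪qsFrame x μ, η⟫ = η 0 + ⟪qsFrame x μ - timeAxis, η⟫ := by
    rw [inner_sub_left, inner_timeAxis_left]; ring
  have h2 : |⟪qsFrame x μ - timeAxis, η⟫| ≤ ‖qsFrame x μ - timeAxis‖ * ‖η‖ := abs_real_inner_le_norm _ _
  have hηn : ‖η‖ ≤ 2 * ‖x‖ := by
    calc ‖η‖ ≤ ‖x i.succ‖ + ‖x (Fin.castSucc i)‖ := norm_sub_le _ _
      _ ≤ ‖x‖ + ‖x‖ := add_le_add (norm_le_pi_norm x _) (norm_le_pi_norm x _)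
      _ = 2 * ‖x‖ := by ring
  have h3 : ‖qsFrame x μ - timeAxis‖ * ‖η‖ ≤ minGap x / 8 := by
    have h4 := norm_qsFrame_sub_le hx μ
    have hε : 2 * qsEps x * (2 * ‖x‖) ≤ minGap x / 8 := by
      unfold qsEps qsC
      rw [show 2 * (minGap x / (4 * (2 * ‖x‖ + 1)) / 4) * (2 * ‖x‖) = minGap x * (‖x‖ / (4 * (2 * ‖x‖ + 1))) by ring]
      have h5 : ‖x‖ / (4 * (2 * ‖x‖ + 1)) ≤ 1 / 8 := by
        rw [div_le_div_iff₀ (by positivity) (by norm_num)]; nlinarith [norm_nonneg x]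
      have h6 := minGap_pos hx
      nlinarith
    calc ‖qsFrame x μ - timeAxis‖ * ‖η‖ ≤ 2 * qsEps x * (2 * ‖x‖) :=
          mul_le_mul h4 hηn (norm_nonneg _) (by linarith [qsEps_pos hx])
      _ ≤ minGap x / 8 := hε
  rw [h1]
  linarith [neg_abs_le ⟪qsFrame x μ - timeAxis, η⟫]

/-! ### Width, gap, base and radius -/

/-- **The width** `t = minGap x / (8 (d + 1))` (all directional coordinates of the parameter point). [folklore] -/
def qsT (x : Fin (k + 2) → EuclideanSpace ℝ (Fin d)) : ℝ := minGap x / (8 * (d + 1))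

/-- **The gap** `g = minGap x / 4`. [folklore] -/
def qsG (x : Fin (k + 2) → EuclideanSpace ℝ (Fin d)) : ℝ := minGap x / 4

/-- **The base** `ξ_i = (x_{i+1} − x_i) − t ∑_ν ê_ν`. [cite: OsterwalderSchraderCMP1975, Ch. V.1 (5.11)–(5.12)] -/
def qsXi (x : Fin (k + 2) → EuclideanSpace ℝ (Fin d)) (i : Fin (k + 1)) : EuclideanSpace ℝ (Fin d) :=
  (x i.succ - x (Fin.castSucc i)) - qsT x • ∑ ν, qsFrame x ν

/-- `t > 0`. [folklore] -/
theorem qsT_pos {x : Fin (k + 2) → EuclideanSpace ℝ (Fin d)} (hx : x ∈ orderedRegion k d) : 0 < qsT x := by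
  unfold qsT; have := minGap_pos hx; positivity

/-- `g > 0`. [folklore] -/
theorem qsG_pos {x : Fin (k + 2) → EuclideanSpace ℝ (Fin d)} (hx : x ∈ orderedRegion k d) : 0 < qsG x := by
  unfold qsG; have := minGap_pos hx; positivity

/-- `t · d ≤ minGap / 8`. [folklore] -/
theorem qsT_mul_le {x : Fin (k + 2) → EuclideanSpace ℝ (Fin d)} (hx : x ∈ orderedRegion k d) : qsT x * d ≤ minGap x / 8 := by
  unfold qsT
  rw [div_mul_eq_mul_div, div_le_div_iff₀ (by positivity) (by norm_num)]
  nlinarith [minGap_pos hx, (Nat.cast_nonneg d : (0 : ℝ) ≤ d)]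

/-- The sum of the norms of the frame vectors is `d`. [folklore] -/
theorem sum_norm_qsFrame {x : Fin (k + 2) → EuclideanSpace ℝ (Fin d)} (hx : x ∈ orderedRegion k d) :
    ∑ ν, ‖qsFrame x ν‖ = d := by
  calc ∑ ν, ‖qsFrame x ν‖ = ∑ _ν : Fin d, (1 : ℝ) := Finset.sum_congr rfl fun ν _ => norm_qsFrame hx ν
    _ = d := by simp

/-- **The gap condition**: `⟪ê_μ, ξ_i⟫ ≥ g`. [cite: OsterwalderSchraderCMP1975, Ch. V.1 (5.7), (5.11)] -/
theorem qsG_le_inner_qsXi {x : Fin (k + 2) → EuclideanSpace ℝ (Fin d)} (hx : x ∈ orderedRegion k d) (μ : Fin d) (i : Fin (k + 1)) :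
    qsG x ≤ ⟪qsFrame x μ, qsXi x i⟫ := by
  have h1 := inner_qsFrame_diff_ge hx μ i
  have hgap : minGap x ≤ x i.succ 0 - x (Fin.castSucc i) 0 := minGap_le x i
  have hsum : ⟪qsFrame x μ, ∑ ν, qsFrame x ν⟫ ≤ d := by
    rw [inner_sum]
    calc ∑ ν, ⟪qsFrame x μ, qsFrame x ν⟫ ≤ ∑ _ν : Fin d, (1 : ℝ) := Finset.sum_le_sum fun ν _ => by
          have := real_inner_le_norm (qsFrame x μ) (qsFrame x ν)
          rw [norm_qsFrame hx, norm_qsFrame hx, one_mul] at this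
          exact this
      _ = d := by simp
  have hsum0 : 0 ≤ ⟪qsFrame x μ, ∑ ν, qsFrame x ν⟫ := by
    rw [inner_sum]; exact Finset.sum_nonneg fun ν _ => inner_qsFrame_nonneg hx μ ν
  have h2 : ⟪qsFrame x μ, qsXi x i⟫ = ⟪qsFrame x μ, x i.succ - x (Fin.castSucc i)⟫ - qsT x * ⟪qsFrame x μ, ∑ ν, qsFrame x ν⟫ := by
    simp only [qsXi, inner_sub_right, inner_smul_right]
  rw [h2]
  have ht : qsT x * ⟪qsFrame x μ, ∑ ν, qsFrame x ν⟫ ≤ minGap x / 8 :=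
    (mul_le_mul_of_nonneg_left hsum (qsT_pos hx).le).trans (qsT_mul_le hx)
  unfold qsG
  nlinarith [minGap_pos hx]

/-- **Size of the base**: `‖ξ‖ ≤ 2‖x‖ + minGap x / 8`. [folklore] -/
theorem norm_qsXi_le {x : Fin (k + 2) → EuclideanSpace ℝ (Fin d)} (hx : x ∈ orderedRegion k d) :
    ‖qsXi x‖ ≤ 2 * ‖x‖ + minGap x / 8 := by
  have ht : qsT x * d ≤ minGap x / 8 := qsT_mul_le hx
  refine (pi_norm_le_iff_of_nonneg (by have := minGap_pos hx; positivity)).2 fun i => ?_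
  unfold qsXi
  refine (norm_sub_le _ _).trans (add_le_add ?_ ?_)
  · calc ‖x i.succ - x (Fin.castSucc i)‖ ≤ ‖x i.succ‖ + ‖x (Fin.castSucc i)‖ := norm_sub_le _ _
      _ ≤ ‖x‖ + ‖x‖ := add_le_add (norm_le_pi_norm x _) (norm_le_pi_norm x _)
      _ = 2 * ‖x‖ := by ring
  · rw [norm_smul, Real.norm_eq_abs, abs_of_pos (qsT_pos hx)]
    exact le_trans (mul_le_mul_of_nonneg_left ((norm_sum_le _ _).trans (sum_norm_qsFrame hx).le) (qsT_pos hx).le) ht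

/-! ### The parameter point -/

/-- **The parameter point** `U₀`: block `0` the coordinates of `x_0` in the frame, every tail
coordinate equal to `t`. [folklore] -/
def qsU0 (x : Fin (k + 2) → EuclideanSpace ℝ (Fin d)) (hli : LinearIndependent ℝ (qsFrame x)) :
    EuclideanSpace ℝ (Fin (k + 2) × Fin d) :=
  WithLp.toLp 2 fun p => Fin.cases (motive := fun _ => ℝ) ((dirBasis (qsFrame x) hli).repr (x 0) p.2) (fun _ => qsT x) p.1

/-- Block `0` of the parameter point. [folklore] -/
theorem qsU0_zero (x : Fin (k + 2) → EuclideanSpace ℝ (Fin d)) (hli : LinearIndependent ℝ (qsFrame x)) (μ : Fin d) :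
    qsU0 x hli (0, μ) = (dirBasis (qsFrame x) hli).repr (x 0) μ := by simp [qsU0]

/-- Tail blocks of the parameter point. [folklore] -/
theorem qsU0_succ (x : Fin (k + 2) → EuclideanSpace ℝ (Fin d)) (hli : LinearIndependent ℝ (qsFrame x)) (i : Fin (k + 1)) (μ : Fin d) :
    qsU0 x hli (i.succ, μ) = qsT x := by simp [qsU0]

/-- **All tail coordinates of the parameter point equal the width.** [folklore] -/
theorem tailR_qsU0 (x : Fin (k + 2) → EuclideanSpace ℝ (Fin d)) (hli : LinearIndependent ℝ (qsFrame x)) (j : Fin (slotK k d + 1)) :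
    tailR (qsU0 x hli) j = qsT x :=
  qsU0_succ x hli _ _

/-- Tail blocks of the parameter point (as a function). [folklore] -/
theorem tailBlocks_qsU0 (x : Fin (k + 2) → EuclideanSpace ℝ (Fin d)) (hli : LinearIndependent ℝ (qsFrame x)) :
    tailBlocks (qsU0 x hli) = fun _ => qsT x :=
  funext fun p => qsU0_succ x hli p.1 p.2

/-- **The parameter point maps to the configuration**: `posAff ξ ê hli U₀ = x`. [folklore] -/
theorem posAff_qsU0 (x : Fin (k + 2) → EuclideanSpace ℝ (Fin d)) (hli : LinearIndependent ℝ (qsFrame x)) :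
    posAff (qsXi x) (qsFrame x) hli (qsU0 x hli) = x := by
  funext j
  rw [posAff_eq_posV, tailBlocks_qsU0]
  have hdir : dirMap (qsFrame x) hli (fun μ => qsU0 x hli (0, μ)) = x 0 := by
    simp_rw [qsU0_zero]
    rw [dirMap_apply]
    conv_rhs => rw [← (dirBasis (qsFrame x) hli).sum_repr (x 0)]
    simp
  have hdiff : ∀ i, dirDiff (qsXi x) (qsFrame x) (fun _ => qsT x) i = x i.succ - x (Fin.castSucc i) := fun i => by
    simp only [dirDiff, qsXi, Finset.smul_sum]
    abel
  rw [hdir, posV]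
  simp_rw [hdiff]
  rw [sum_filter_succ_sub_castSucc]
  abel

/-! ### The radius -/

/-- **The radius** `r = t sin(π / (4 (K + 1)))` of the ball in parameter space. [folklore] -/
def qsR (x : Fin (k + 2) → EuclideanSpace ℝ (Fin d)) : ℝ := qsT x * Real.sin (Real.pi / (4 * (slotK k d + 1)))

/-- The angle `π / (4 (K+1))` has a sine in `(0, 1)`. [folklore] -/
theorem sin_angle_pos_lt_one (K : ℕ) : 0 < Real.sin (Real.pi / (4 * (K + 1))) ∧ Real.sin (Real.pi / (4 * (K + 1))) < 1 := by
  have hα0 : 0 < Real.pi / (4 * (K + 1)) := by positivity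
  have hα1 : Real.pi / (4 * (K + 1)) ≤ 1 := by
    rw [div_le_one (by positivity)]
    have h1 : (1 : ℝ) ≤ K + 1 := by simp
    nlinarith [Real.pi_le_four]
  exact ⟨Real.sin_pos_of_pos_of_lt_pi hα0 (hα1.trans_lt (by linarith [Real.two_le_pi])), (Real.sin_lt hα0).trans_le hα1⟩

/-- `r > 0`. [folklore] -/
theorem qsR_pos {x : Fin (k + 2) → EuclideanSpace ℝ (Fin d)} (hx : x ∈ orderedRegion k d) : 0 < qsR x :=
  mul_pos (qsT_pos hx) (sin_angle_pos_lt_one _).1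

/-- `r < t`. [folklore] -/
theorem qsR_lt_qsT {x : Fin (k + 2) → EuclideanSpace ℝ (Fin d)} (hx : x ∈ orderedRegion k d) : qsR x < qsT x :=
  mul_lt_of_lt_one_right (qsT_pos hx) (sin_angle_pos_lt_one _).2

/-- The radius condition of the density theorems: `r ≤ tailR U₀ j · sin(π/(4(K+1)))`. [folklore] -/
theorem qsR_le_tailR (x : Fin (k + 2) → EuclideanSpace ℝ (Fin d)) (hli : LinearIndependent ℝ (qsFrame x)) (j : Fin (slotK k d + 1)) :
    qsR x ≤ tailR (qsU0 x hli) j * Real.sin (Real.pi / (4 * (slotK k d + 1))) := by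
  rw [tailR_qsU0]; rfl

end Literature.MathematicalPhysics.QuantumFieldTheory
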